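import Summits.QuantumFields.YangMills.Theses.FradkinShenkerFlow
import Literature.MathematicalPhysics.QuantumFieldTheory.LatticeGaugeProofs

/-!
# `SusceptibilityToPoincare` — negative side: the bottleneck (conductance) lemma for the heat-bath Poincaré inequality

Negative-side support for crux `stmt-QuantumFields-9441`
(`Summit.QuantumFields.YangMills.Theses.FradkinShenkerFlow.SusceptibilityToPoincare`, FS ⇒ UP), extracted from the
standing disprover's work file `Cruxes/SusceptibilityToPoincare/Disproof.lean` §1. The crux's conclusion UP is a
UNIFORM single-link heat-bath Poincaré inequality `Var_{μ_{β,S}} F ≤ C Σ_ℓ ∫∫ (F U − F(U[ℓ ↦ g]))² dν_ℓ^U dμ_{β,S}`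
for all bounded measurable `F` on every torus of side `2S+1`. Tested on INDICATORS it says that every measurable
event `A ⊆ G^{E}` has heat-bath boundary flux at least `μ(A)(1 − μ(A))/C`:

* `variance_indicator_wilsonMeasure` — `Var_{μ_{β,S}}(1_A) = μ(A)(1 − μ(A))` (the Wilson measure is a probability
  measure for a continuous representation, tree `isProbabilityMeasure_wilsonMeasure`);
* `measureReal_mul_le_of_heatBathPoincare` — the Poincaré inequality with constant `C` on the side-`(2S+1)` torus gives
  `μ(A)(1 − μ(A)) ≤ C · ℰ_hb(1_A)`;
* `not_uniformHeatBathPoincare_of_bottleneck` — hence a family of measurable events `A S` with Wilson mass in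
  `[δ, 1 − δ]`, `δ > 0`, whose heat-bath flux tends to `0` as `S → ∞` REFUTES UP(r, β) (verbatim the crux
  conclusion) for that `(G, r, β)`.

This is the shape of every known obstruction to UP ('t Hooft twist sectors for centreless `G`, centre sectors for
disconnected `G`, phase coexistence at bulk first-order points); the companion file
`Negative/FalseOfTwistSectorInputs.lean` feeds it the SO(3) twist-sector hypothesis. Every compact `G`, every
lattice representation `r`, every real `β`; nothing here asserts a Theses statement.
-/

noncomputable section

namespace Summit.QuantumFields.YangMills.Theorems.SusceptibilityToPoincare.Negative

open MeasureTheory ProbabilityTheory Filter Topology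
open Literature.MathematicalPhysics.QuantumFieldTheory

variable {G : Type} [Group G] [TopologicalSpace G] [IsTopologicalGroup G] [CompactSpace G]
  [MeasurableSpace G] [BorelSpace G]

/-- Variance of an indicator under the torus Wilson measure: `Var(1_A) = μ(A)(1 − μ(A))`. [folklore] -/
theorem variance_indicator_wilsonMeasure (r : LatticeRep G) (β : ℝ) (S : ℕ)
    {A : Set (GaugeConfig 4 (2 * S + 1) G)} (hA : MeasurableSet A) :
    variance (A.indicator (1 : GaugeConfig 4 (2 * S + 1) G → ℝ)) (wilsonMeasure (d := 4) (L := 2 * S + 1) r.ρ β) =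
      (wilsonMeasure (d := 4) (L := 2 * S + 1) r.ρ β).real A *
        (1 - (wilsonMeasure (d := 4) (L := 2 * S + 1) r.ρ β).real A) := by
  haveI := isProbabilityMeasure_wilsonMeasure (d := 4) (L := 2 * S + 1) (G := G) r.ρ r.continuous β
  have hmeas : Measurable (A.indicator (1 : GaugeConfig 4 (2 * S + 1) G → ℝ)) :=
    measurable_one.indicator hA
  have hX : MemLp (A.indicator (1 : GaugeConfig 4 (2 * S + 1) G → ℝ)) 2
      (wilsonMeasure (d := 4) (L := 2 * S + 1) r.ρ β) :=
    MemLp.of_bound hmeas.aestronglyMeasurable 1 (ae_of_all _ fun U => by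
      by_cases hU : U ∈ A <;> simp [Set.indicator, hU])
  have hsq : (A.indicator (1 : GaugeConfig 4 (2 * S + 1) G → ℝ)) ^ 2 =
      A.indicator (1 : GaugeConfig 4 (2 * S + 1) G → ℝ) := by
    funext U
    by_cases hU : U ∈ A <;> simp [Set.indicator, hU]
  rw [variance_eq_sub hX, hsq, integral_indicator_one hA]
  ring

/-- **Bottleneck lemma.** If the single-link heat-bath Poincaré inequality holds with constant `C` for all bounded
measurable `F` on the torus of side `2S+1`, then every measurable event `A` satisfies
`μ(A)(1 − μ(A)) ≤ C · Σ_ℓ ∫∫ (1_A U − 1_A(U[ℓ ↦ g]))² dν_ℓ^U dμ` (apply it to `F = 1_A`). [folklore] -/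
theorem measureReal_mul_le_of_heatBathPoincare (r : LatticeRep G) (β C : ℝ) (S : ℕ)
    (hC : ∀ F : GaugeConfig 4 (2 * S + 1) G → ℝ, Measurable F → (∃ M : ℝ, ∀ U, |F U| ≤ M) →
      variance F (wilsonMeasure (d := 4) (L := 2 * S + 1) r.ρ β) ≤
        C * ∑ ℓ : Edge 4 (2 * S + 1), ∫ U, ∫ g, (F U - F (Function.update U ℓ g)) ^ 2
          ∂((haarProbability G).tilted (fun g' => -β * wilsonAction r.ρ (Function.update U ℓ g')))
          ∂(wilsonMeasure (d := 4) (L := 2 * S + 1) r.ρ β))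
    {A : Set (GaugeConfig 4 (2 * S + 1) G)} (hA : MeasurableSet A) :
    (wilsonMeasure (d := 4) (L := 2 * S + 1) r.ρ β).real A *
        (1 - (wilsonMeasure (d := 4) (L := 2 * S + 1) r.ρ β).real A) ≤
      C * ∑ ℓ : Edge 4 (2 * S + 1), ∫ U, ∫ g,
          (A.indicator (1 : GaugeConfig 4 (2 * S + 1) G → ℝ) U - A.indicator 1 (Function.update U ℓ g)) ^ 2
        ∂((haarProbability G).tilted (fun g' => -β * wilsonAction r.ρ (Function.update U ℓ g')))
        ∂(wilsonMeasure (d := 4) (L := 2 * S + 1) r.ρ β) := by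
  rw [← variance_indicator_wilsonMeasure r β S hA]
  exact hC _ (measurable_one.indicator hA) ⟨1, fun U => by
    by_cases hU : U ∈ A <;> simp [Set.indicator, hU]⟩

omit [TopologicalSpace G] [IsTopologicalGroup G] [CompactSpace G] [MeasurableSpace G] [BorelSpace G] [Group G] in
/-- `δ ≤ p ≤ 1 − δ` ⟹ `δ(1 − δ) ≤ p(1 − p)`, since `p(1 − p) − δ(1 − δ) = (p − δ)(1 − δ − p)`. [folklore] -/
theorem mul_one_sub_le_mul_one_sub {p δ : ℝ} (h₁ : δ ≤ p) (h₂ : p ≤ 1 - δ) :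
    δ * (1 - δ) ≤ p * (1 - p) := by
  nlinarith [mul_nonneg (sub_nonneg.2 h₁) (sub_nonneg.2 h₂)]

/-- **No uniform heat-bath Poincaré inequality across a bottleneck.** If along the tori of sides `2S+1` there are
measurable events `A S` of Wilson mass in `[δ, 1 − δ]` (`δ > 0`) whose single-link heat-bath boundary flux
`Σ_ℓ ∫∫ (1_{A S} U − 1_{A S}(U[ℓ ↦ g]))² dν_ℓ^U dμ_{β,S}` tends to `0`, then UP(r, β) — verbatim the conclusion of
`SusceptibilityToPoincare` at `(G, r, β)` — is false. [folklore] -/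
theorem not_uniformHeatBathPoincare_of_bottleneck (r : LatticeRep G) (β : ℝ) {δ : ℝ} (hδ : 0 < δ)
    (A : ∀ S : ℕ, Set (GaugeConfig 4 (2 * S + 1) G)) (hmeas : ∀ S, MeasurableSet (A S))
    (hmass : ∀ S, δ ≤ (wilsonMeasure (d := 4) (L := 2 * S + 1) r.ρ β).real (A S) ∧
      (wilsonMeasure (d := 4) (L := 2 * S + 1) r.ρ β).real (A S) ≤ 1 - δ)
    (hflux : Tendsto (fun S : ℕ => ∑ ℓ : Edge 4 (2 * S + 1), ∫ U, ∫ g,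
        ((A S).indicator (1 : GaugeConfig 4 (2 * S + 1) G → ℝ) U - (A S).indicator 1 (Function.update U ℓ g)) ^ 2
      ∂((haarProbability G).tilted (fun g' => -β * wilsonAction r.ρ (Function.update U ℓ g')))
      ∂(wilsonMeasure (d := 4) (L := 2 * S + 1) r.ρ β)) atTop (𝓝 0)) :
    ¬ ∃ C : ℝ, ∀ S : ℕ, ∀ F : GaugeConfig 4 (2 * S + 1) G → ℝ, Measurable F → (∃ M : ℝ, ∀ U, |F U| ≤ M) →
      variance F (wilsonMeasure (d := 4) (L := 2 * S + 1) r.ρ β) ≤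
        C * ∑ ℓ : Edge 4 (2 * S + 1), ∫ U, ∫ g, (F U - F (Function.update U ℓ g)) ^ 2
          ∂((haarProbability G).tilted (fun g' => -β * wilsonAction r.ρ (Function.update U ℓ g')))
          ∂(wilsonMeasure (d := 4) (L := 2 * S + 1) r.ρ β) := by
  rintro ⟨C, hC⟩
  have hδ1 : δ ≤ 1 - δ := (hmass 0).1.trans (hmass 0).2
  have hpos : 0 < δ * (1 - δ) := mul_pos hδ (by linarith)
  have hle : ∀ S : ℕ, δ * (1 - δ) ≤ C * ∑ ℓ : Edge 4 (2 * S + 1), ∫ U, ∫ g,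
        ((A S).indicator (1 : GaugeConfig 4 (2 * S + 1) G → ℝ) U - (A S).indicator 1 (Function.update U ℓ g)) ^ 2
      ∂((haarProbability G).tilted (fun g' => -β * wilsonAction r.ρ (Function.update U ℓ g')))
      ∂(wilsonMeasure (d := 4) (L := 2 * S + 1) r.ρ β) := fun S =>
    (mul_one_sub_le_mul_one_sub (hmass S).1 (hmass S).2).trans
      (measureReal_mul_le_of_heatBathPoincare r β C S (hC S) (hmeas S))
  have hlim := hflux.const_mul C
  rw [mul_zero] at hlim
  have : δ * (1 - δ) ≤ 0 := ge_of_tendsto hlim (Eventually.of_forall hle)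
  linarith

end Summit.QuantumFields.YangMills.Theorems.SusceptibilityToPoincare.Negative
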